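import Literature.IUT.HodgeTheaters.InitialThetaDataTorsionClaimsModelGeometry
import HarnessLib

/-!
# [IUTchI] §1 pp. 37–38 EVALUATED at the semidirect CLAIMS MODEL: `Δ_X̲`, the cusp inertia, `modLKer = deltaEpsKer = 1`,
# `jKer = 1 × ((1 × ℤ·g) ⋊ 1)`, `Π_{X→} = G × ((1 × ℤ·g) ⋊ 1)`, `galKer = 1 × ((1 × ℤ·g) ⋊ {±1})`,
# `Π_{C→} = G × ((1 × ℤ·g) ⋊ {±1})` (proof-only companion, part 4a of the JOINT-NV row)

S. Mochizuki, *Inter-universal Teichmüller theory I*, kurims manuscript (May 2020), §1 p. 37 «Let `Δ_X̲ ↠ Δ_X̲^{ab} ⊗ (ℤ/lℤ)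
↠ Δ_ε` be the quotient by the images of the inertia groups of all nonzero cusps `≠ ε′, ε″`», p. 38 «the action by `ι` on
`Δ_ε` determines a decomposition into eigenspaces `Δ_ε ⥲ Δ_ε⁺ × Δ_ε⁻`», «Let `Δ_X̲ ↠ Δ_X̲^{ab} ⊗ (ℤ/lℤ) ↠ Δ_ε ↠ Δ_ε⁺`
… `J_X`», «the subgroup `Im(σ) ⊆ J_X` determines an open subgroup `Π_{X→} ⊆ Π_X̲`», «the inverse image of
`Im(σ) × Gal(X̲/C̲)` determines an open subgroup `Π_{C→} ⊆ Π_C̲`» ([IUTchI] §1 p.37–38) [claim: Mochizuki2012, status: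
disputed] (D-0012 claim key; series status DISPUTED — theorems about a MODEL of the cell's `π₁`-interface structures;
nothing of the series is asserted; no side taken on [IUTchIII] Cor. 3.12).

## WHAT (proof-only; 0 definitions; the model = `InitialThetaDataTorsionClaimsModel{,KLevel,Geometry}.lean`)

abc-iut-L5-t1's §1 construction evaluated at `TorsionClaimsModel.pedOf G g h5 h6` (`Π_{C_K} = G × ((W × E_F[l](F̄)) ⋊ {±1})`,
`W = ℤ/l` the synthetic inertia line, `D_{ε⁰} = D_{ε′} = D_{ε″} = G × dW`, `D_{2ε} = G × 1`): `Δ_X̲ = 1 × ((W × ℤ·g) ⋊ 1)`,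
`I_{ε′} = I_{ε″} = 1 × ((W × 1) ⋊ 1)` NONTRIVIAL (`inertia_ε1_ne_bot`), `I_{2ε} = 1`, `modLKer = deltaEpsKer = 1`,
**`jKer = 1 × ((1 × ℤ·g) ⋊ 1)`** (`jKer_eq`: the commutators `[x, ι̲] = inl (1, t²)` sweep the line — squaring is onto `ℤ·g`
for `l` odd — and the `ι`-fixed inertia coordinate dies), `Π_{X→} = G × dLine g`, **`galKer = 1 × ((1 × ℤ·g) ⋊ {±1})`**,
`Π_{C→} = G × dLinePM g`.  The thirteen printed claims and the joint witness: part 4b `…ClaimsModelProofs.lean`.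

HONEST LABEL.  Computations in a MODEL (synthetic rank-1 inertia line fixed by the involution; finite `Δ_X`); typed ≠
inhabited ≠ discharged; instantiated ≠ endorsed; no side taken on [IUTchIII] Cor. 3.12.
-/

noncomputable section

namespace Literature.IUT.HodgeTheaters

universe u

namespace TorsionClaimsModel

open Literature.AnabelianGeometry.AbsoluteAnabelian Topology
open TorsionMonodromyModel
open scoped WeierstrassCurve.Affine Classical

variable {F : Type u} [Field F] {E : WeierstrassCurve F} {Fbar : Type u} [Field Fbar] [Algebra F Fbar] {l : ℕ}

/-! ## Arithmetic of the finite factor `Dih = (W × E_F[l]) ⋊ {±1}` -/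

namespace Dih

/-- `t ^ l = 1` in `W = ℤ/l` (multiplicatively). [folklore] -/
private theorem pow_l_eq_one_W [NeZero l] (w : Multiplicative (ZMod l)) : w ^ l = 1 := by
  have h := pow_card_eq_one' (G := Multiplicative (ZMod l)) (x := w)
  rwa [Nat.card_congr Multiplicative.toAdd, Nat.card_zmod] at h

/-- `N = W × E_F[l](F̄)` has exponent `l`. [cite: Mochizuki2012, IUTchI §1 p.37] -/
theorem pow_l_N [NeZero l] (n : N E Fbar l) : n ^ l = 1 :=
  Prod.ext (pow_l_eq_one_W n.1) (Tors.pow_l n.2)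

/-- An element of `Dih` with trivial sign is `inl` of its `N`-coordinate. [cite: Mochizuki2012, IUTchI Def 3.1 (d) p.62] -/
theorem eq_inl_of_right_eq_one {k : Dih E Fbar l} (hk : k.right = 1) : k = SemidirectProduct.inl k.left := by
  rw [← SemidirectProduct.inl_left_mul_inr_right k, hk, map_one, mul_one, SemidirectProduct.left_inl]

/-- **Conjugation in `Dih`**: `d · inl a · d⁻¹ = inl (sgnN d.right a)` (`N` commutative). [cite: Mochizuki2012, IUTchI Def 3.1 (d) p.62] -/
theorem conj_inl (d : Dih E Fbar l) (a : N E Fbar l) :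
    d * SemidirectProduct.inl a * d⁻¹ = SemidirectProduct.inl (sgnN E Fbar l d.right a) := by
  conv_lhs => rw [← SemidirectProduct.inl_left_mul_inr_right d]
  rw [mul_inv_rev, ← map_inv, ← map_inv]
  calc SemidirectProduct.inl d.left * SemidirectProduct.inr d.right * SemidirectProduct.inl a *
        (SemidirectProduct.inr d.right⁻¹ * SemidirectProduct.inl d.left⁻¹)
      = SemidirectProduct.inl d.left *
          (SemidirectProduct.inr d.right * SemidirectProduct.inl a * SemidirectProduct.inr d.right⁻¹) *
          SemidirectProduct.inl d.left⁻¹ := by simp only [mul_assoc]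
    _ = SemidirectProduct.inl (d.left * sgnN E Fbar l d.right a * d.left⁻¹) := by
        rw [← SemidirectProduct.inl_aut, map_mul, map_mul]
    _ = SemidirectProduct.inl (sgnN E Fbar l d.right a) := by rw [mul_comm d.left, mul_inv_cancel_right]

/-- **The commutator with the involution** (`d` of sign `−1`): `inl a · d · (inl a)⁻¹ · d⁻¹ = inl (1, (a.2)²)` — the
inertia coordinate dies (`ι` fixes `W`), the torsion coordinate is doubled. [cite: Mochizuki2012, IUTchI §1 p.38] -/
theorem comm_inl_of_right_eq_neg_one (a : N E Fbar l) {d : Dih E Fbar l} (hd : d.right = -1) :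
    SemidirectProduct.inl a * d * (SemidirectProduct.inl a)⁻¹ * d⁻¹ = SemidirectProduct.inl (1, a.2 * a.2) := by
  have h : d * (SemidirectProduct.inl a)⁻¹ * d⁻¹ = SemidirectProduct.inl (sgnN E Fbar l d.right a⁻¹) := by
    rw [← map_inv, conj_inl]
  rw [mul_assoc, mul_assoc, ← mul_assoc d, h, ← map_mul, sgnN_apply, hd]
  congr 1
  refine Prod.ext ?_ ?_
  · show a.1 * a⁻¹.1 = 1
    rw [Prod.fst_inv, mul_inv_cancel]
  · show a.2 * a⁻¹.2 ^ ((-1 : ℤˣ) : ℤ) = a.2 * a.2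
    rw [Prod.snd_inv, Units.val_neg, Units.val_one, zpow_neg, zpow_one, inv_inv]

/-- In `ℤ·g` every element is a square (`g` has odd order `l`): `s = (s ^ ((l+1)/2))²` — why the commutators `[x, ι̲]`
sweep the whole line `ℤ·g`. [cite: Mochizuki2012, IUTchI §1 p.38] -/
theorem exists_sq_eq_of_mem_zpowers [NeZero l] (h6 : l.Coprime 6) {g s : Tors E Fbar l}
    (hs : s ∈ Subgroup.zpowers g) : ∃ t ∈ Subgroup.zpowers g, t * t = s := by
  have hodd : Odd l := Nat.coprime_two_right.mp (h6.coprime_dvd_right (by norm_num))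
  obtain ⟨k, hk⟩ := hodd
  refine ⟨s ^ (k + 1), Subgroup.pow_mem _ hs _, ?_⟩
  rw [← pow_add, show k + 1 + (k + 1) = l + 1 by omega, pow_succ, Tors.pow_l, one_mul]

/-- For `d ∈ Dih` with trivial inertia coordinate and sign `−1`, `d² = 1` (the involution inverts `E_F[l]`).
[cite: Mochizuki2012, IUTchI §1 p.38] -/
theorem mul_self_eq_one_of {d : Dih E Fbar l} (h1 : d.left.1 = 1) (hr : d.right = -1) : d * d = 1 := by
  refine SemidirectProduct.ext ?_ ?_
  · rw [SemidirectProduct.mul_left, SemidirectProduct.one_left, sgnN_apply, hr]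
    refine Prod.ext ?_ ?_
    · show d.left.1 * d.left.1 = 1
      rw [h1, mul_one]
    · show d.left.2 * d.left.2 ^ ((-1 : ℤˣ) : ℤ) = 1
      rw [Units.val_neg, Units.val_one, zpow_neg, zpow_one, mul_inv_cancel]
  · rw [SemidirectProduct.mul_right, SemidirectProduct.one_right, hr]
    decide

/-- Hence such a `d` is its own `l`-th power (`l` odd). [cite: Mochizuki2012, IUTchI §1 p.38] -/
theorem pow_l_eq_self_of (h6 : l.Coprime 6) {d : Dih E Fbar l} (h1 : d.left.1 = 1) (hr : d.right = -1) :
    d ^ l = d := by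
  obtain ⟨k, hk⟩ : Odd l := Nat.coprime_two_right.mp (h6.coprime_dvd_right (by norm_num))
  have h : d ^ (2 * k + 1) = d := by
    rw [pow_succ, pow_mul, pow_two, mul_self_eq_one_of h1 hr, one_pow, one_mul]
  rw [← hk] at h
  exact h

/-- The inertia coordinate of an `l`-th power is trivial (`W` has exponent `l`). [cite: Mochizuki2012, IUTchI §1 p.38] -/
theorem wCoord_pow_l [NeZero l] (d : Dih E Fbar l) : wCoord E Fbar l (d ^ l) = 1 := by
  rw [map_pow]
  have h := pow_card_eq_one' (G := Multiplicative (ZMod l)) (x := wCoord E Fbar l d)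
  rwa [Nat.card_congr Multiplicative.toAdd, Nat.card_zmod] at h

end Dih

/-! ## The §1 construction at `pedOf G g h5 h6` -/

section Claims

variable (G : Type u) [Group G] [TopologicalSpace G] [IsTopologicalGroup G] [CompactSpace G]
  [TotallyDisconnectedSpace G] [E.IsElliptic] [NeZero l] (g : Tors E Fbar l) (h5 : 5 ≤ l) (h6 : l.Coprime 6)

/-- `Δ_C = Ker(pr₁)`. [cite: Mochizuki2012, IUTchI §1 p.37] -/
theorem mem_DeltaC_iff {x : G × Dih E Fbar l} : x ∈ (pedOf G g h5 h6).DeltaC ↔ x.1 = 1 :=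
  (extK G).mem_geom

/-- `Δ_X̲ = 1 × dXbar g`. [cite: Mochizuki2012, IUTchI §1 p.37] -/
theorem mem_DeltaXbar_iff {x : G × Dih E Fbar l} :
    x ∈ (pedOf G g h5 h6).DeltaXbar ↔ x.1 = 1 ∧ x.2 ∈ Dih.dXbar F E g := by
  rw [PuncturedEllipticData.DeltaXbar, pedOf_PiXbar]
  constructor
  · intro h
    exact ⟨(mem_DeltaC_iff G g h5 h6).mp h.2, mem_lift.mp h.1⟩
  · rintro ⟨h1, h2⟩
    exact ⟨mem_lift.mpr h2, (mem_DeltaC_iff G g h5 h6).mpr h1⟩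

/-- `Δ_C̲ = 1 × dC g`. [cite: Mochizuki2012, IUTchI §1 p.37] -/
theorem mem_DeltaCbar_iff {x : G × Dih E Fbar l} :
    x ∈ (pedOf G g h5 h6).DeltaCbar ↔ x.1 = 1 ∧ x.2 ∈ Dih.dC F E g := by
  rw [PuncturedEllipticData.DeltaCbar]
  constructor
  · intro h
    exact ⟨(mem_DeltaC_iff G g h5 h6).mp h.2, mem_lift.mp h.1⟩
  · rintro ⟨h1, h2⟩
    exact ⟨mem_lift.mpr h2, (mem_DeltaC_iff G g h5 h6).mpr h1⟩

/-- **NONTRIVIAL inertia**: for `x ≠ 2ε`, `I_x = 1 × dW` (the synthetic inertia line). [cite: Mochizuki2012, IUTchI §1 p.37] -/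
theorem mem_inertia_iff_of_ne {x : ULift.{u} (Fin 4)} (hx : x ≠ ⟨3⟩) {z : G × Dih E Fbar l} :
    z ∈ (pedOf G g h5 h6).inertia x ↔ z.1 = 1 ∧ z.2 ∈ Dih.dW F E := by
  rw [PuncturedEllipticData.inertia, pedOf_decomp_of_ne G g h5 h6 hx]
  constructor
  · intro h
    exact ⟨(mem_DeltaC_iff G g h5 h6).mp h.2, mem_lift.mp h.1⟩
  · rintro ⟨h1, h2⟩
    exact ⟨mem_lift.mpr h2, (mem_DeltaC_iff G g h5 h6).mpr h1⟩

/-- The inertia of the label `2ε` is trivial (`D_{2ε} = G × 1`). [cite: Mochizuki2012, IUTchI §1 p.37] -/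
theorem inertia_twoε_eq_bot : (pedOf G g h5 h6).inertia (pedOf G g h5 h6).twoε = ⊥ := by
  rw [eq_bot_iff, PuncturedEllipticData.inertia, pedOf_decomp_twoε]
  intro z hz
  have h2 : z.2 = 1 := Subgroup.mem_bot.mp (mem_lift.mp hz.1)
  have h1 : z.1 = 1 := (mem_DeltaC_iff G g h5 h6).mp hz.2
  exact Subgroup.mem_bot.mpr (Prod.ext h1 h2)

/-- Elements of `Δ_X̲` commute (the finite factor `N ⋊ 1` is commutative). [cite: Mochizuki2012, IUTchI §1 p.37] -/
theorem comm_of_mem_DeltaXbar {a b : G × Dih E Fbar l} (ha : a ∈ (pedOf G g h5 h6).DeltaXbar)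
    (hb : b ∈ (pedOf G g h5 h6).DeltaXbar) : a * b = b * a := by
  obtain ⟨ha1, ha2⟩ := (mem_DeltaXbar_iff G g h5 h6).mp ha
  obtain ⟨hb1, hb2⟩ := (mem_DeltaXbar_iff G g h5 h6).mp hb
  refine Prod.ext ?_ ?_
  · show a.1 * b.1 = b.1 * a.1
    rw [ha1, hb1]
  · show a.2 * b.2 = b.2 * a.2
    have h := Dih.comm_eq_one ((Dih.mem_dXbar_iff _ _).mp ha2).1 ((Dih.mem_dXbar_iff _ _).mp hb2).1
    rw [mul_inv_eq_one, mul_inv_eq_iff_eq_mul] at h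
    exact h

/-- `Δ_X̲` has exponent `l`. [cite: Mochizuki2012, IUTchI §1 p.37] -/
theorem pow_l_eq_one_of_mem_DeltaXbar {y : G × Dih E Fbar l} (hy : y ∈ (pedOf G g h5 h6).DeltaXbar) :
    y ^ l = 1 := by
  obtain ⟨hy1, hy2⟩ := (mem_DeltaXbar_iff G g h5 h6).mp hy
  have hy2' : y.2 = SemidirectProduct.inl y.2.left := Dih.eq_inl_of_right_eq_one ((Dih.mem_dXbar_iff _ _).mp hy2).1
  refine Prod.ext ?_ ?_
  · show y.1 ^ l = 1
    rw [hy1, one_pow]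
  · show y.2 ^ l = 1
    rw [hy2', ← map_pow, Dih.pow_l_N, map_one]

/-- In a `T₁` topological group the trivial subgroup is topologically closed. [folklore] -/
private theorem topologicalClosure_bot' {Ω : Type*} [Group Ω] [TopologicalSpace Ω] [IsTopologicalGroup Ω]
    [T1Space Ω] : (⊥ : Subgroup Ω).topologicalClosure = ⊥ :=
  le_antisymm (Subgroup.topologicalClosure_minimal _ le_rfl
    (by rw [Subgroup.coe_bot]; exact isClosed_singleton)) bot_le

/-- **`modLKer = Ker(Δ_X̲ ↠ Δ_X̲^{ab} ⊗ ℤ/l) = 1`** at the model (`Δ_X̲` abelian of exponent `l`). [cite: Mochizuki2012, IUTchI §1 p.37] -/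
theorem modLKer_eq_bot : (pedOf G g h5 h6).modLKer = ⊥ := by
  rw [PuncturedEllipticData.modLKer]
  have hcomm : ⁅(pedOf G g h5 h6).DeltaXbar, (pedOf G g h5 h6).DeltaXbar⁆ = ⊥ := by
    rw [Subgroup.commutator_eq_bot_iff_le_centralizer]
    intro x hx
    rw [Subgroup.mem_centralizer_iff]
    intro y hy
    exact comm_of_mem_DeltaXbar G g h5 h6 hy hx
  have hpow : Subgroup.closure ((fun y => y ^ (pedOf G g h5 h6).l) ''
      ((pedOf G g h5 h6).DeltaXbar : Set (pedOf G g h5 h6).PiC)) = ⊥ := by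
    rw [Subgroup.closure_eq_bot_iff]
    rintro _ ⟨y, hy, rfl⟩
    exact pow_l_eq_one_of_mem_DeltaXbar G g h5 h6 hy
  rw [hcomm, hpow, bot_sup_eq]
  exact topologicalClosure_bot'

/-- The only cusp label other than `ε⁰, ε′, ε″` is `2ε`. [folklore] -/
private theorem eq_three_of_ne {x : ULift.{u} (Fin 4)} (h0 : x ≠ ⟨0⟩) (h1 : x ≠ ⟨1⟩) (h2 : x ≠ ⟨2⟩) : x = ⟨3⟩ := by
  obtain ⟨i⟩ := x
  fin_cases i
  · exact absurd rfl h0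
  · exact absurd rfl h1
  · exact absurd rfl h2
  · rfl

/-- **`deltaEpsKer = 1`** at the model: the only nonzero label `≠ ε′, ε″` is `2ε`, with trivial inertia. [cite: Mochizuki2012, IUTchI §1 p.37] -/
theorem deltaEpsKer_eq_bot : (pedOf G g h5 h6).deltaEpsKer = ⊥ := by
  rw [PuncturedEllipticData.deltaEpsKer, modLKer_eq_bot, bot_sup_eq, iSup_eq_bot]
  rintro ⟨x, hx0, hx1, hx2⟩
  have hx : x = ⟨3⟩ := eq_three_of_ne hx0 hx1 hx2
  subst hx
  exact inertia_twoε_eq_bot G g h5 h6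

/-- The element `ι̲ := (1, ⟨1, −1⟩)` lies in `Δ_C̲ ∖ Δ_X̲`. [cite: Mochizuki2012, IUTchI §1 p.38] -/
theorem iota_mem : ((1 : G), (SemidirectProduct.inr (-1) : Dih E Fbar l)) ∈ (pedOf G g h5 h6).DeltaCbar ∧
    ((1 : G), (SemidirectProduct.inr (-1) : Dih E Fbar l)) ∉ (pedOf G g h5 h6).DeltaXbar := by
  refine ⟨(mem_DeltaCbar_iff G g h5 h6).mpr ⟨rfl, ?_⟩, fun h => ?_⟩
  · rw [Dih.mem_dC_iff, SemidirectProduct.left_inr, Prod.snd_one]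
    exact one_mem _
  · have h1 := ((Dih.mem_dXbar_iff _ _).mp ((mem_DeltaXbar_iff G g h5 h6).mp h).2).1
    rw [SemidirectProduct.right_inr] at h1
    exact absurd (congrArg Units.val h1) (by decide)

/-- **`jKer = 1 × dLine g = 1 × ((1 × ℤ·g) ⋊ 1)`** at the model: the commutators `[x, c]` (`x ∈ Δ_X̲`, `c ∈ Δ_C̲ ∖ Δ_X̲`, i.e.
`c` of sign `−1`) are exactly the `inl (1, t²)`, `t ∈ ℤ·g`, and squaring is onto `ℤ·g`.
[cite: Mochizuki2012, IUTchI §1 p.38] -/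
theorem jKer_eq : (pedOf G g h5 h6).jKer = (Dih.dLine F E g).map (MonoidHom.inr G (Dih E Fbar l)) := by
  rw [PuncturedEllipticData.jKer, deltaEpsKer_eq_bot, bot_sup_eq]
  refine le_antisymm ?_ ?_
  · rw [Subgroup.closure_le]
    rintro z ⟨x, hx, c, hc, hcX, rfl⟩
    obtain ⟨hx1, hx2⟩ := (mem_DeltaXbar_iff G g h5 h6).mp hx
    obtain ⟨hc1, hc2⟩ := (mem_DeltaCbar_iff G g h5 h6).mp hc
    obtain ⟨hxr, hxg⟩ := (Dih.mem_dXbar_iff _ _).mp hx2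
    -- `c ∉ Δ_X̲` with `c ∈ Δ_C̲` means `c.2.right ≠ 1`, i.e. `= −1`
    have hcr : c.2.right = -1 := by
      rcases Int.units_eq_one_or c.2.right with h | h
      · exact absurd ((mem_DeltaXbar_iff G g h5 h6).mpr ⟨hc1, (Dih.mem_dXbar_iff _ _).mpr ⟨h, hc2⟩⟩) hcX
      · exact h
    have hx2' : x.2 = SemidirectProduct.inl x.2.left := Dih.eq_inl_of_right_eq_one hxr
    refine ⟨SemidirectProduct.inl (1, x.2.left.2 * x.2.left.2), ⟨rfl, rfl, ?_⟩, ?_⟩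
    · show ((1 : Multiplicative (ZMod l)), x.2.left.2 * x.2.left.2).2 ∈ Subgroup.zpowers g
      exact mul_mem hxg hxg
    · refine Prod.ext ?_ ?_
      · show (1 : G) = x.1 * c.1 * x.1⁻¹ * c.1⁻¹
        rw [hx1, hc1, inv_one, mul_one, mul_one, mul_one]
      · show SemidirectProduct.inl (1, x.2.left.2 * x.2.left.2) = x.2 * c.2 * x.2⁻¹ * c.2⁻¹
        conv_rhs => rw [hx2']
        rw [Dih.comm_inl_of_right_eq_neg_one _ hcr]
  · rintro _ ⟨d, ⟨hdr, hd1, hdg⟩, rfl⟩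
    obtain ⟨t, ht, htt⟩ := Dih.exists_sq_eq_of_mem_zpowers h6 hdg
    have hd : d = SemidirectProduct.inl (1, t * t) := by
      rw [Dih.eq_inl_of_right_eq_one hdr]
      congr 1
      exact Prod.ext hd1 htt.symm
    -- `inr d = [x, ι̲]` with `x = inr (inl (1, t))`
    refine Subgroup.subset_closure ⟨((1 : G), SemidirectProduct.inl ((1 : Multiplicative (ZMod l)), t)), ?_,
      ((1 : G), SemidirectProduct.inr (-1)), (iota_mem G g h5 h6).1, (iota_mem G g h5 h6).2, ?_⟩
    · exact (mem_DeltaXbar_iff G g h5 h6).mpr ⟨rfl, (Dih.mem_dXbar_iff _ _).mpr ⟨rfl, ht⟩⟩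
    · refine Prod.ext ?_ ?_
      · show (1 : G) = 1 * 1 * 1⁻¹ * 1⁻¹
        rw [inv_one, mul_one, mul_one, mul_one]
      · show d = SemidirectProduct.inl ((1 : Multiplicative (ZMod l)), t) * SemidirectProduct.inr (-1) *
          (SemidirectProduct.inl ((1 : Multiplicative (ZMod l)), t))⁻¹ * (SemidirectProduct.inr (-1))⁻¹
        rw [Dih.comm_inl_of_right_eq_neg_one _ (SemidirectProduct.right_inr _), hd]

/-- Membership form of `jKer_eq`. [cite: Mochizuki2012, IUTchI §1 p.38] -/
theorem mem_jKer_iff {z : G × Dih E Fbar l} :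
    z ∈ (pedOf G g h5 h6).jKer ↔ z.1 = 1 ∧ z.2 ∈ Dih.dLine F E g := by
  rw [jKer_eq]
  exact ⟨fun ⟨d, hd, hdz⟩ => hdz ▸ ⟨rfl, hd⟩, fun ⟨h1, h2⟩ => ⟨z.2, h2, Prod.ext h1.symm rfl⟩⟩

/-- `Δ_X̲ = inr(dXbar g)`. [cite: Mochizuki2012, IUTchI §1 p.37] -/
theorem DeltaXbar_eq : (pedOf G g h5 h6).DeltaXbar = (Dih.dXbar F E g).map (MonoidHom.inr G (Dih E Fbar l)) := by
  ext z
  exact ⟨fun h => ⟨z.2, ((mem_DeltaXbar_iff G g h5 h6).mp h).2, Prod.ext ((mem_DeltaXbar_iff G g h5 h6).mp h).1.symm rfl⟩,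
    fun ⟨d, hd, hdz⟩ => hdz ▸ (mem_DeltaXbar_iff G g h5 h6).mpr ⟨rfl, hd⟩⟩

/-- **`Π_{X→} = G × dLine g`** at the model (`D_{2ε} = G × 1`, `jKer = 1 × dLine g`). [cite: Mochizuki2012, IUTchI §1 p.38] -/
theorem mem_piXarrow_iff {z : G × Dih E Fbar l} : z ∈ (pedOf G g h5 h6).piXarrow ↔ z.2 ∈ Dih.dLine F E g := by
  rw [PuncturedEllipticData.piXarrow, pedOf_decomp_twoε]
  constructor
  · intro hz
    have hle : lift G ⊥ ⊔ (pedOf G g h5 h6).jKer ≤ lift G (Dih.dLine F E g) :=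
      sup_le (lift_mono G bot_le) (fun y hy => mem_lift.mpr ((mem_jKer_iff G g h5 h6).mp hy).2)
    exact mem_lift.mp (hle hz)
  · intro hz
    have h : z = ((z.1, 1) : G × Dih E Fbar l) * (1, z.2) := by
      refine Prod.ext ?_ ?_
      · show z.1 = z.1 * 1
        rw [mul_one]
      · show z.2 = 1 * z.2
        rw [one_mul]
    rw [h]
    exact Subgroup.mul_mem_sup (mem_lift.mpr (Subgroup.mem_bot.mpr rfl))
      ((mem_jKer_iff G g h5 h6).mpr ⟨rfl, hz⟩)

/-- Subgroup form: **`Π_{X→} = G × dLine g`**. [cite: Mochizuki2012, IUTchI §1 p.38] -/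
theorem piXarrow_eq : (pedOf G g h5 h6).piXarrow = lift G (Dih.dLine F E g) := by
  ext z
  exact (mem_piXarrow_iff G g h5 h6).trans mem_lift.symm

/-- **`galKer = 1 × dLinePM g = 1 × ((1 × ℤ·g) ⋊ {±1})`** at the model (`galKer = jKer ⊔ ⟨l-th powers of Δ_C̲⟩`): an `l`-th
power of `⟨(w, t), u⟩ ∈ Δ_C̲` has trivial inertia coordinate and lies in `dC g`; conversely `⟨(1, s), 1⟩ ∈ jKer` and
`⟨(1, s), −1⟩` is its own `l`-th power. [cite: Mochizuki2012, IUTchI §1 p.38] -/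
theorem mem_galKer_iff {z : G × Dih E Fbar l} :
    z ∈ (pedOf G g h5 h6).galKer ↔ z.1 = 1 ∧ z.2 ∈ Dih.dLinePM F E g := by
  constructor
  · intro hz
    have hle : (pedOf G g h5 h6).galKer ≤ (Dih.dLinePM F E g).map (MonoidHom.inr G (Dih E Fbar l)) := by
      rw [PuncturedEllipticData.galKer]
      refine sup_le ?_ ?_
      · rw [jKer_eq]
        exact Subgroup.map_mono (Dih.dLine_le_dLinePM g)
      · rw [Subgroup.closure_le]
        rintro _ ⟨y, hy, rfl⟩
        obtain ⟨hy1, hy2⟩ := (mem_DeltaCbar_iff G g h5 h6).mp hy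
        refine ⟨y.2 ^ l, (Dih.mem_dLinePM_iff _ _).mpr ⟨?_, ?_⟩, Prod.ext ?_ rfl⟩
        · exact (Dih.mem_dC_iff _ _).mp (Subgroup.pow_mem _ hy2 _)
        · exact Dih.wCoord_pow_l (E := E) (Fbar := Fbar) (l := l) y.2
        · show (1 : G) = (y ^ (pedOf G g h5 h6).l).1
          show (1 : G) = y.1 ^ l
          rw [hy1, one_pow]
    obtain ⟨d, hd, hdz⟩ := hle hz
    subst hdz
    exact ⟨rfl, hd⟩
  · rintro ⟨hz1, hz2⟩
    obtain ⟨hzg, hzw⟩ := (Dih.mem_dLinePM_iff _ _).mp hz2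
    rw [PuncturedEllipticData.galKer]
    rcases Int.units_eq_one_or z.2.right with hr | hr
    · exact Subgroup.mem_sup_left ((mem_jKer_iff G g h5 h6).mpr ⟨hz1, hr, hzw, hzg⟩)
    · refine Subgroup.mem_sup_right (Subgroup.subset_closure ⟨z, ?_, ?_⟩)
      · exact (mem_DeltaCbar_iff G g h5 h6).mpr ⟨hz1, hz2.1⟩
      · show z ^ l = z
        refine Prod.ext ?_ ?_
        · show z.1 ^ l = z.1
          rw [hz1, one_pow]
        · show z.2 ^ l = z.2
          exact Dih.pow_l_eq_self_of h6 hzw hr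

/-- **`Π_{C→} = G × dLinePM g`** at the model (`D_{2ε} = G × 1`, `galKer = 1 × dLinePM g`). [cite: Mochizuki2012, IUTchI §1 p.38] -/
theorem mem_piCarrow_iff {z : G × Dih E Fbar l} : z ∈ (pedOf G g h5 h6).piCarrow ↔ z.2 ∈ Dih.dLinePM F E g := by
  rw [PuncturedEllipticData.piCarrow, pedOf_decomp_twoε]
  constructor
  · intro hz
    have hle : lift G ⊥ ⊔ (pedOf G g h5 h6).galKer ≤ lift G (Dih.dLinePM F E g) :=
      sup_le (lift_mono G bot_le) (fun y hy => mem_lift.mpr ((mem_galKer_iff G g h5 h6).mp hy).2)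
    exact mem_lift.mp (hle hz)
  · intro hz
    have h : z = ((z.1, 1) : G × Dih E Fbar l) * (1, z.2) := by
      refine Prod.ext ?_ ?_
      · show z.1 = z.1 * 1
        rw [mul_one]
      · show z.2 = 1 * z.2
        rw [one_mul]
    rw [h]
    exact Subgroup.mul_mem_sup (mem_lift.mpr (Subgroup.mem_bot.mpr rfl))
      ((mem_galKer_iff G g h5 h6).mpr ⟨rfl, hz⟩)

/-- Subgroup form: **`Π_{C→} = G × dLinePM g`**. [cite: Mochizuki2012, IUTchI §1 p.38] -/
theorem piCarrow_eq : (pedOf G g h5 h6).piCarrow = lift G (Dih.dLinePM F E g) := by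
  ext z
  exact (mem_piCarrow_iff G g h5 h6).trans mem_lift.symm

end Claims

end TorsionClaimsModel

end Literature.IUT.HodgeTheaters

end
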